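import Summits.RiemannHypothesis.RiemannHypothesis.Theorems.GroundBartaPolarPerronFrobeniusConeBottom
import Summits.RiemannHypothesis.RiemannHypothesis.Theorems.GroundBartaPolarPerronFrobeniusFormDomainEven
import Summits.RiemannHypothesis.RiemannHypothesis.Theorems.WeilWindowFlowWindowLipschitzStubFormDomainPos
import Summits.RiemannHypothesis.RiemannHypothesis.Theorems.WeilWindowFlowWindowLipschitzStubSupBoundAux
import Summits.RiemannHypothesis.RiemannHypothesis.Theorems.OddSectorOddOneSignedWindowsOddFormDomainPos
import Summits.RiemannHypothesis.RiemannHypothesis.Theorems.OddSectorOddOneSignedWindowsFormDomainTools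
import Literature.NumberTheory.LFunctions.WeilGroundStateRealZerosProofs
import HarnessLib

/-!
# Crux `PolarPerronFrobenius` (stmt-RiemannHypothesis-18390): the CONE BOTTOM `ε₊(a)` is bounded by every
# non-negative even form-domain vector

Helper file (`--supports stmt-RiemannHypothesis-18390`), RH-free, no definitions, no named facts; prover B g16.
B seat 3 reduced the sign crux at a window to the equality `ε₊(a) = ε(a)` of two continuous antitone energies
(`oneSigned_iff_coneBottom_eq`, `Theorems/GroundBartaPolarPerronFrobeniusConeBottom.lean`; `ε₊(a) :=
sInf (weilWindowSphereValues P₊ a)`, `P₊ g := ∀ t, Im g(t) = 0 ∧ 0 ≤ Re g(t)`, written out).  The cone bottom is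
bounded above by the Rayleigh quotient of every non-negative TEST function; this file extends that variational handle to
the FORM DOMAIN, which is where the certified Ritz vectors of the parity ladder live (window polynomials
`𝟙_{[-b,b]} P(x/b)`, continuous inside, a jump at the edge):

* `coneBottom_formDomain_le` — for `a > 0` and every EVEN `f ∈ L²` vanishing off `[-a, a]`, pointwise real `≥ 0`,
  with finite archimedean energy, `(M_a + ε₊(a)) ‖f‖₂² ≤ P(f) + 𝓔_a(f)`.

This is the cone twin of `WeilWindowFlowWindowLipschitz.stub_formDomainPos` (`(M_a + ε(a))‖f‖² ≤ P(f) + 𝓔_a(f)`,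
Fukushima–Oshima–Takeda core property) and its proof is that file's, run inside the cone: mollify `f` by normalised
even bumps (`exists_even_nonneg_mollified_seq`, B seat 3 — the mollified functions stay non-negative and even, live on
the window `a + 1/(n+1)`, have dominated increments and converge in `L²`), apply the homogeneous cone bound
`ε₊(bₙ)‖gₙ‖² ≤ Re Q(gₙ)` (`sInf_weilWindowSphereValues_mul_le_re`, the cone is stable under positive scalars) with the
Markov decomposition on `[-bₙ, bₙ]`, compare energies of nested windows (new prime lengths see saturated increments),
and pass to the limit with the continuity of `ε₊` (`continuousAt_coneBottom`).  The helper lemmas of the stub file are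
`private` there; their public twins are reused (`OddSector.weilDirichletEnergy_window'`,
`OddSector.tendsto_weilPoleForm_of_window`, `WeilWindowFlowWindowLipschitz.stub_supBound_weilMarkovConstant_mono`).
Consumers: `Theorems/GroundBartaPolarPerronFrobeniusRitzSignNearBottom.lean` (`ε₊(83/100) ≤ 483·10⁻²¹`,
`ε₊(4023/5000) ≤ 10⁻¹⁷` from the certified non-negative Ritz vectors).
References: M. Fukushima, Y. Oshima, M. Takeda, *Dirichlet Forms and Symmetric Markov Processes* (2011) §1.1;
E. Bombieri, Rend. Lincei (9) 11 (2000) §4 Problem 2, Thm 5 [Bombieri2000Weil]; M. Suzuki, arXiv:2606.09096 Thm 1.3.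
-/

set_option linter.dupNamespace false

noncomputable section

open MeasureTheory Set Filter ContinuousLinearMap
open scoped Topology ENNReal NNReal ComplexConjugate Convolution ArithmeticFunction.vonMangoldt

namespace Summit.RiemannHypothesis.RiemannHypothesis.Theorems.PolarPerronFrobenius

open Literature.NumberTheory.LFunctions Literature.NumberTheory.LFunctions.ConnesVanSuijlekom

/-! ## One step inside the cone and the limit -/

/-- **One step, cone version.** For a NON-NEGATIVE test function `g` on `[-b, b]`, `b ≥ a`, whose increments are dominated by
those of a finite-energy `f` living on `[-a, a]`:
`ε₊(b)‖g‖² + M_a‖f‖² + M_b(‖g‖² − ‖f‖²) ≤ P(g) + 𝓔_a(f)`. [folklore] -/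
theorem coneBottom_step_le {a b : ℝ} (hab : a ≤ b) {f g : ℝ → ℂ} (hf : MemLp f 2)
    (hfs : ∀ x, x ∉ Icc (-a) a → f x = 0)
    (harch : IntegrableOn (fun t ↦ weilArchDensity t * weilIncrement f t) (Ioi 0))
    (hg : IsWeilTest g) (hgs : tsupport g ⊆ Icc (-b) b) (hgP : ∀ t, (g t).im = 0 ∧ 0 ≤ (g t).re)
    (hD : ∀ t, weilIncrement g t ≤ weilIncrement f t) :
    sInf (weilWindowSphereValues (fun g : ℝ → ℂ ↦ ∀ t, (g t).im = 0 ∧ 0 ≤ (g t).re) b) * (∫ x, ‖g x‖ ^ 2) +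
        weilMarkovConstant a * (∫ x, ‖f x‖ ^ 2) +
        weilMarkovConstant b * ((∫ x, ‖g x‖ ^ 2) - ∫ x, ‖f x‖ ^ 2) ≤
      weilPoleForm g + weilDirichletEnergy a f := by
  -- adapted from WeilWindowFlowWindowLipschitzStubFormDomainPos (private step_le): ε(b) ↦ ε₊(b)
  have h1 := sInf_weilWindowSphereValues_mul_le_re
    (P := fun g : ℝ → ℂ ↦ ∀ t, (g t).im = 0 ∧ 0 ≤ (g t).re) hg hgs (fun c hc t ↦ by
      refine ⟨?_, ?_⟩
      · simp [Complex.mul_im, (hgP t).1]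
      · simp only [Complex.mul_re, Complex.ofReal_re, Complex.ofReal_im, (hgP t).1, mul_zero, sub_zero]
        exact mul_nonneg hc.le (hgP t).2)
  have h2 := weilQuadratic_re_eq_weilPoleForm_add_weilDirichletEnergy_sub hg hgs
  have h3 : weilDirichletEnergy b g ≤ weilDirichletEnergy b f := by
    unfold weilDirichletEnergy
    refine add_le_add (Finset.sum_le_sum fun n _ ↦ mul_le_mul_of_nonneg_left (hD _)
      (div_nonneg ArithmeticFunction.vonMangoldt_nonneg (Real.sqrt_nonneg _))) ?_
    refine integral_mono_of_nonneg ?_ harch ?_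
    · exact (ae_restrict_iff' measurableSet_Ioi).2 (Eventually.of_forall fun t ht ↦
        mul_nonneg (weilArchDensity_pos ht).le (weilIncrement_nonneg _ t))
    · exact (ae_restrict_iff' measurableSet_Ioi).2 (Eventually.of_forall fun t ht ↦
        mul_le_mul_of_nonneg_left (hD t) (weilArchDensity_pos ht).le)
  have h4 := OddSector.weilDirichletEnergy_window' hab hf hfs
  rw [sub_mul] at h4
  rw [mul_sub]
  linarith

/-- **The cone bottom is bounded by every non-negative even form-domain vector**: for `a > 0` and `f ∈ L²` vanishing
off `[-a, a]`, even, pointwise real `≥ 0`, with finite archimedean energy,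
`(M_a + ε₊(a)) ‖f‖₂² ≤ P(f) + 𝓔_a(f)`. [folklore] -/
theorem coneBottom_formDomain_le {a : ℝ} (ha : 0 < a) {f : ℝ → ℂ} (hf : MemLp f 2)
    (hfs : ∀ x, x ∉ Icc (-a) a → f x = 0) (hfe : ∀ x, f (-x) = f x)
    (hfr : ∀ x, (f x).im = 0 ∧ 0 ≤ (f x).re)
    (harch : IntegrableOn (fun t ↦ weilArchDensity t * weilIncrement f t) (Ioi 0)) :
    (weilMarkovConstant a +
        sInf (weilWindowSphereValues (fun g : ℝ → ℂ ↦ ∀ t, (g t).im = 0 ∧ 0 ≤ (g t).re) a)) *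
        ∫ x, ‖f x‖ ^ 2 ≤
      weilPoleForm f + weilDirichletEnergy a f := by
  -- adapted from WeilWindowFlowWindowLipschitzStubFormDomainPos (private core_le): mollify inside the cone
  obtain ⟨g, hg, -, hgP, hgs, hD, hlim⟩ := exists_even_nonneg_mollified_seq hf hfs hfe hfr
  have hr0 : ∀ n : ℕ, (0 : ℝ) < 1 / ((n : ℝ) + 1) := fun n ↦ by positivity
  have hr1 : ∀ n : ℕ, 1 / ((n : ℝ) + 1) ≤ 1 := fun n ↦
    div_le_one_of_le₀ (by linarith [n.cast_nonneg (α := ℝ)]) (by positivity)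
  have hgm : ∀ n, MemLp (g n) 2 := fun n ↦ (hg n).memLp_two
  -- norms and pole forms converge
  have hN : Tendsto (fun n ↦ ∫ x, ‖g n x‖ ^ 2) atTop (𝓝 (∫ x, ‖f x‖ ^ 2)) :=
    tendsto_integral_norm_sq hf hgm hlim
  have hfR : ∀ x, x ∉ Icc (-(a + 1)) (a + 1) → f x = 0 := fun x hx ↦
    hfs x fun h ↦ hx (Icc_subset_Icc (by linarith) (by linarith) h)
  have hgR : ∀ n x, x ∉ Icc (-(a + 1)) (a + 1) → g n x = 0 := fun n x hx ↦
    image_eq_zero_of_notMem_tsupport fun h ↦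
      hx (Icc_subset_Icc (by linarith [hr1 n]) (by linarith [hr1 n]) (hgs n h))
  have hP : Tendsto (fun n ↦ weilPoleForm (g n)) atTop (𝓝 (weilPoleForm f)) :=
    OddSector.tendsto_weilPoleForm_of_window hf hgm hfR hgR hlim
  -- windows and cone bottoms converge
  have hb : Tendsto (fun n : ℕ ↦ a + 1 / ((n : ℝ) + 1)) atTop (𝓝 a) := by
    have := (tendsto_const_nhds (x := a) (f := (atTop : Filter ℕ))).add
      (tendsto_one_div_add_atTop_nhds_zero_nat (𝕜 := ℝ))
    rwa [add_zero] at this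
  have hε : Tendsto (fun n : ℕ ↦ sInf (weilWindowSphereValues
      (fun g : ℝ → ℂ ↦ ∀ t, (g t).im = 0 ∧ 0 ≤ (g t).re) (a + 1 / ((n : ℝ) + 1)))) atTop
      (𝓝 (sInf (weilWindowSphereValues (fun g : ℝ → ℂ ↦ ∀ t, (g t).im = 0 ∧ 0 ≤ (g t).re) a))) :=
    (continuousAt_coneBottom ha).tendsto.comp hb
  -- the killing constants stay bounded, so `M_{bₙ}(‖gₙ‖² − ‖f‖²) → 0`
  have hMB : ∀ n : ℕ, |weilMarkovConstant (a + 1 / ((n : ℝ) + 1))| ≤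
      |weilMarkovConstant a| + |weilMarkovConstant (a + 1)| := fun n ↦ by
    have h1 := WeilWindowFlowWindowLipschitz.stub_supBound_weilMarkovConstant_mono
      (show a ≤ a + 1 / ((n : ℝ) + 1) by linarith [hr0 n])
    have h2 := WeilWindowFlowWindowLipschitz.stub_supBound_weilMarkovConstant_mono
      (show a + 1 / ((n : ℝ) + 1) ≤ a + 1 by linarith [hr1 n])
    rcases abs_cases (weilMarkovConstant (a + 1 / ((n : ℝ) + 1))) with h | h <;>
    rcases abs_cases (weilMarkovConstant a) with h' | h' <;>
    rcases abs_cases (weilMarkovConstant (a + 1)) with h'' | h'' <;> linarith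
  have hM : Tendsto (fun n : ℕ ↦ weilMarkovConstant (a + 1 / ((n : ℝ) + 1)) *
      ((∫ x, ‖g n x‖ ^ 2) - ∫ x, ‖f x‖ ^ 2)) atTop (𝓝 0) := by
    refine squeeze_zero_norm (fun n ↦ ?_)
      (a := fun n ↦ (|weilMarkovConstant a| + |weilMarkovConstant (a + 1)|) *
        |(∫ x, ‖g n x‖ ^ 2) - ∫ x, ‖f x‖ ^ 2|) ?_
    · rw [norm_mul, Real.norm_eq_abs, Real.norm_eq_abs]
      exact mul_le_mul_of_nonneg_right (hMB n) (abs_nonneg _)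
    · have := (tendsto_sub_nhds_zero_iff.2 hN).abs.const_mul
        (|weilMarkovConstant a| + |weilMarkovConstant (a + 1)|)
      simpa using this
  -- pass to the limit in the one-step inequality
  have hL := ((hε.mul hN).add (tendsto_const_nhds
    (x := weilMarkovConstant a * ∫ x, ‖f x‖ ^ 2) (f := (atTop : Filter ℕ)))).add hM
  have hR := hP.add (tendsto_const_nhds (x := weilDirichletEnergy a f) (f := (atTop : Filter ℕ)))
  have key := le_of_tendsto_of_tendsto' hL hR fun n ↦
    coneBottom_step_le (show a ≤ a + 1 / ((n : ℝ) + 1) by linarith [hr0 n]) hf hfs harch (hg n) (hgs n)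
      (hgP n) (hD n)
  rw [add_mul]
  linarith

end Summit.RiemannHypothesis.RiemannHypothesis.Theorems.PolarPerronFrobenius

end
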